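import Mathlib
import Literature.Analysis.ODE.RegularSingularAnalyticBranch
import Summits.AtomisticToContinuum.HydrodynamicLimit.Theorems.ImplosionDichotomyDenseExcursionSonicCavityDefsB

/-!
# The complex-analytic extension of a tube profile at the sonic point
# (crux `DenseExcursion`, line `sonic-cavity-renewal` v6, brick (M3a, part 1) for the registered helper `sonicSlaving_of_tube`)

Helper file (`--supports stmt-AtomisticToContinuum-12586`, line lead a2, stub-worker W2 for `sonicSlaving_of_tube`).

Clause (e) of `CavityTube` gives the profile as real power series `W x = Σ aₘ xᵐ`, `S x = Σ bₘ xᵐ` on `|x| < 1/10` with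
`|aₘ|, |bₘ| ≤ 10ᵐ`. This file turns that into the form the analytic (Frobenius) theory of the mode system at the sonic point consumes:
holomorphic functions `Wc, Sc` on the complex disc `‖z‖ < 1/10` which restrict to `W, S` on the real trace, together with the
compatibility of the complex derivative with the real one (`deriv Wc x = deriv W x` for real `|x| < 1/10`):

* `hasFPowerSeriesOnBall_tubeSeries`: `z ↦ Σ zᵐ • aₘ` has the power series `coeffSeries a` on the ball of radius `1/10`
  (`Literature.Analysis.ODE.hasFPowerSeriesOnBall_tsum_pow_smul` with `B = 1`, `λ = 10`);
* `tubeSeries_ofReal`: on the real trace it equals the real sum;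
* `deriv_eq_ofReal_deriv_of_eventuallyEq`: a holomorphic function agreeing with `x ↦ (W x : ℂ)` near a real point has complex
  derivative `(deriv W x : ℂ)` there;
* `cavityTube_complex_extension` (registered helper): the packaged statement.

This is step (M3a)(1) of the worker report `work/stubs/W2_sonicSlaving.REPORT.md` (analyticity of smooth radial modes at the sonic
point); it is also the entry point of the contour-transport architecture proposed there. No citation is load-bearing.
-/

noncomputable section

open Set Filter Metric
open scoped Topology NNReal

namespace Summit.AtomisticToContinuum.HydrodynamicLimit.Theorems.SonicCavityRenewal

open Summit.AtomisticToContinuum.HydrodynamicLimit.Theorems.R2OneModeTwoConditions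
open Literature.Analysis.ODE

/-- A tube coefficient sequence (`|aₘ| ≤ 10ᵐ`), cast to `ℂ`, is geometrically bounded with `B = 1`, `λ = 10`. [folklore] -/
theorem norm_tubeCoeff_le {a : ℕ → ℝ} (ha : ∀ m, |a m| ≤ 10 ^ m) (m : ℕ) : ‖(a m : ℂ)‖ ≤ 1 * (10 : ℝ) ^ m := by
  rw [Complex.norm_real, Real.norm_eq_abs, one_mul]
  exact ha m

/-- THE COMPLEX EXTENSION OF A TUBE SERIES IS HOLOMORPHIC ON THE DISC OF RADIUS `1/10`: `z ↦ Σ zᵐ • aₘ` has the power series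
`coeffSeries a` on `‖z‖ < 1/10`. [folklore] -/
theorem hasFPowerSeriesOnBall_tubeSeries {a : ℕ → ℝ} (ha : ∀ m, |a m| ≤ 10 ^ m) :
    HasFPowerSeriesOnBall (fun z : ℂ => ∑' m, z ^ m • (a m : ℂ)) (coeffSeries fun m => (a m : ℂ)) 0 ((1 / 10 : ℝ≥0)) :=
  hasFPowerSeriesOnBall_tsum_pow_smul (𝕜 := ℂ) (norm_tubeCoeff_le ha) (by norm_num) (by norm_num) (by norm_num)

/-- The complex extension is holomorphic (analytic on a neighbourhood of every point) on the open disc `‖z‖ < 1/10`. [folklore] -/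
theorem analyticOnNhd_tubeSeries {a : ℕ → ℝ} (ha : ∀ m, |a m| ≤ 10 ^ m) :
    AnalyticOnNhd ℂ (fun z : ℂ => ∑' m, z ^ m • (a m : ℂ)) (ball 0 (1 / 10)) := by
  have h := (hasFPowerSeriesOnBall_tubeSeries ha).analyticOnNhd
  have e : ((1 / 10 : ℝ≥0) : ℝ) = 1 / 10 := by norm_num
  rw [Metric.eball_coe, e] at h
  exact h

/-- ON THE REAL TRACE the complex extension is the real sum: if `Σ aₘ xᵐ = W x` (real, `|x| < 1/10`) then
`Σ (x : ℂ)ᵐ • aₘ = W x`. [folklore] -/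
theorem tubeSeries_ofReal {a : ℕ → ℝ} {W : ℝ → ℝ} {x : ℝ} (hx : HasSum (fun m => a m * x ^ m) (W x)) :
    (∑' m, (x : ℂ) ^ m • (a m : ℂ)) = (W x : ℂ) := by
  have h : HasSum (fun m => ((a m * x ^ m : ℝ) : ℂ)) (W x : ℂ) := (Complex.hasSum_ofReal (L := SummationFilter.unconditional ℕ)).2 hx
  have h' : HasSum (fun m => (x : ℂ) ^ m • (a m : ℂ)) (W x : ℂ) := by
    convert h using 2 with m
    push_cast
    rw [smul_eq_mul]
    ring
  exact h'.tsum_eq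

/-- DERIVATIVE COMPATIBILITY: a function `Wc : ℂ → ℂ` that is complex-differentiable at the real point `x` and agrees with
`t ↦ (W t : ℂ)` for real `t` near `x`, `W` differentiable at `x`, has `deriv Wc x = deriv W x`. [folklore] -/
theorem deriv_eq_ofReal_deriv_of_eventuallyEq {Wc : ℂ → ℂ} {W : ℝ → ℝ} {x : ℝ} (hWc : DifferentiableAt ℂ Wc x)
    (hW : DifferentiableAt ℝ W x) (heq : ∀ᶠ t : ℝ in 𝓝 x, Wc t = W t) : deriv Wc x = ((deriv W x : ℝ) : ℂ) := by
  have h1 : HasDerivAt (fun t : ℝ => Wc t) (deriv Wc x) x := hWc.hasDerivAt.comp_ofReal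
  have h2 : HasDerivAt (fun t : ℝ => (W t : ℂ)) ((deriv W x : ℝ) : ℂ) x := hW.hasDerivAt.ofReal_comp
  exact (h1.congr_of_eventuallyEq (heq.mono fun t ht => ht.symm)).unique h2

/-- Real points of the disc: `|x| < 1/10` iff `(x : ℂ) ∈ ball 0 (1/10)`. [folklore] -/
theorem ofReal_mem_ball_iff {x ρ : ℝ} : (x : ℂ) ∈ ball (0 : ℂ) ρ ↔ |x| < ρ := by
  rw [mem_ball, dist_zero_right, Complex.norm_real, Real.norm_eq_abs]

/-- **THE COMPLEX EXTENSION OF A TUBE PROFILE AT THE SONIC POINT** — registered helper `cavityTube_complex_extension` for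
`sonicSlaving_of_tube`. For a monatomic profile in the cavity tube there are functions `Wc, Sc : ℂ → ℂ`, holomorphic on the disc
`‖z‖ < 1/10`, with `Wc x = W x`, `Sc x = S x`, `deriv Wc x = deriv W x`, `deriv Sc x = deriv S x` for every real `|x| < 1/10`
(clause (e) of `CavityTube` summed over `ℂ`; the derivative clause by uniqueness of the real derivative of the common restriction).
This is the input of the analytic branch of the mode system at the sonic point and of any contour argument near it. [folklore] -/
theorem cavityTube_complex_extension : ∀ (r : ℝ) (W S : ℝ → ℝ), IsMonatomicProfile r W S → CavityTube r W S → ∃ Wc Sc : ℂ → ℂ, AnalyticOnNhd ℂ Wc (Metric.ball 0 (1 / 10)) ∧ AnalyticOnNhd ℂ Sc (Metric.ball 0 (1 / 10)) ∧ ∀ x : ℝ, |x| < 1 / 10 → Wc (x : ℂ) = ((W x : ℝ) : ℂ) ∧ Sc (x : ℂ) = ((S x : ℝ) : ℂ) ∧ deriv Wc (x : ℂ) = ((deriv W x : ℝ) : ℂ) ∧ deriv Sc (x : ℂ) = ((deriv S x : ℝ) : ℂ) := by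
  intro r W S hP hT
  obtain ⟨-, -, hW, hS, -⟩ := hP
  obtain ⟨-, -, -, -, -, -, -, -, -, -, a, b, hab, hsum⟩ := hT
  have hW1 : Differentiable ℝ W := hW.differentiable (by simp)
  have hS1 : Differentiable ℝ S := hS.differentiable (by simp)
  set Wc : ℂ → ℂ := fun z => ∑' m, z ^ m • (a m : ℂ) with hWc
  set Sc : ℂ → ℂ := fun z => ∑' m, z ^ m • (b m : ℂ) with hSc
  have hWa : AnalyticOnNhd ℂ Wc (ball 0 (1 / 10)) := analyticOnNhd_tubeSeries fun m => (hab m).1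
  have hSa : AnalyticOnNhd ℂ Sc (ball 0 (1 / 10)) := analyticOnNhd_tubeSeries fun m => (hab m).2
  have hWx : ∀ x : ℝ, |x| < 1 / 10 → Wc x = ((W x : ℝ) : ℂ) := fun x hx => tubeSeries_ofReal (hsum x hx).1
  have hSx : ∀ x : ℝ, |x| < 1 / 10 → Sc x = ((S x : ℝ) : ℂ) := fun x hx => tubeSeries_ofReal (hsum x hx).2
  refine ⟨Wc, Sc, hWa, hSa, fun x hx => ⟨hWx x hx, hSx x hx, ?_, ?_⟩⟩
  · have hnear : ∀ᶠ t : ℝ in 𝓝 x, Wc t = W t :=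
      (eventually_of_mem (isOpen_Ioo.mem_nhds (abs_lt.1 hx)) fun t ht => hWx t (abs_lt.2 ht))
    exact deriv_eq_ofReal_deriv_of_eventuallyEq ((hWa x (ofReal_mem_ball_iff.2 hx)).differentiableAt) (hW1 x) hnear
  · have hnear : ∀ᶠ t : ℝ in 𝓝 x, Sc t = S t :=
      (eventually_of_mem (isOpen_Ioo.mem_nhds (abs_lt.1 hx)) fun t ht => hSx t (abs_lt.2 ht))
    exact deriv_eq_ofReal_deriv_of_eventuallyEq ((hSa x (ofReal_mem_ball_iff.2 hx)).differentiableAt) (hS1 x) hnear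

end Summit.AtomisticToContinuum.HydrodynamicLimit.Theorems.SonicCavityRenewal

end
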